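import Literature.Topology.FourManifolds.SphereSurgeryPiOneOfComplement
import HarnessLib

/-!
# Surgery on spheres of codimension two and more: the sphere complement is simply connected
# when the surgered manifold is

Topic `Literature/Topology/FourManifolds`; a proof file (no definitions, no named facts), the
converse companion of `SphereSurgeryPiOneOfComplement.lean`.  For a simultaneous surgery
`χ(X, φ₁, …, φᵣ)` along a finite disjoint framed family of `k`-spheres `Sᵢ` with normal fibre
`ℝˡ⁺¹` (Milnor 1965, Def. 3.11 and §3 p. 21; the tree's `FramedSphereFamily`,
`FramedSphereFamily.IsSurgery`, `FramedSphereFamily.Surgered`) the surgered space `P` contains the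
cocores `S'ᵢ = jB(i, 0, Sˡ)`, spheres `Sˡ` with product neighbourhoods `Sˡ × ℝᵏ⁺¹`, and
`P ∖ ⋃ S'ᵢ = jA(X ∖ ⋃ Sᵢ)` (`compl_iUnion_coCore_eq_range`).  When `k + 1 ≥ 3` the punctured
fibre `ℝᵏ⁺¹ ∖ 0` is simply connected, so removing the cocores does not change the fundamental
group (Kosinski 1993, X.2, proof of Thm. 2.2; the tree's
`simplyConnectedSpace_compl_iUnion_core_iff`): **`X ∖ ⋃ Sᵢ` is simply connected iff `P` is.**
The companion file proves "if"; this file proves "only if" and records the equivalence, in the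
three forms in which the tree speaks of surgery:

* `FramedSphereFamily.simplyConnectedSpace_compl_of_surgery_family`,
  `FramedSphereFamily.simplyConnectedSpace_iff_compl_of_surgery_family` — relational gluing form
  `P = jA(X ∖ ⋃ Sᵢ) ∪ jB(ι × OD^{k+1} × Sˡ)` (`k ≥ 2`, `l ≥ 1`);
* `FramedSphereFamily.simplyConnectedSpace_compl_of_surgered_family` (and `_iff_`) — for the
  surgered manifold `ν.Surgered hkl` of the tree (`SphereFamilySurgeryExistence.lean`);
* `FramedSphereFamily.IsSurgery.simplyConnectedSpace_compl`, `….simplyConnectedSpace_of_compl`,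
  `….simplyConnectedSpace_iff_compl` — for the relational predicate `ν.IsSurgery IP P`
  (`SphereFamilySurgery.lean`), the vocabulary of the cork decomposition theorem
  (`Literature.Topology.FourManifolds.Matveyev1996_partOne_and_fact_of_dualSpheres`);
* `FramedSphereFamily.IsSurgery.simplyConnectedSpace_compl_two_two` — **the four-dimensional
  case**: if a simply connected 4-manifold `X₁` is obtained from `N` by surgery along a finite
  disjoint framed family `P₁, …, P_k` of 2-spheres (each `S² × D²` replaced by `D³ × S¹`), then
  `N ∖ ⋃ Pⱼ` is simply connected — the cocores are circles of codimension `3` in `X₁`.  This is the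
  sentence *"Each of `l'ᵢ` is contractible in `N ∖ S_*`, as well as in `N ∖ P_*`, since the latter
  two are simply-connected manifolds"* of Matveyev 1996 (Proof of Theorem, p. 1: surgery along
  `{Pᵢ}` gives the simply connected `M₁`, along `{Sᵢ}` gives `M₂`), read through the surgered
  manifolds rather than through the product decompositions `φ₁`, `φ₂` of `N`.

Everything is a theorem; spaces live in `Type` as in the companion files.

## References

* A. Kosinski, *Differential Manifolds* (1993), Ch. X §2, Thm. (2.2) and its proof (p. 201).
  [Kosinski1993]
* J. Milnor, *Lectures on the h-cobordism theorem* (1965), Def. 3.11 (PDF p. 17), §3 p. 21.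
  [MilnorHCobordism1965]
* R. Matveyev, *A decomposition of smooth simply-connected h-cobordant 4-manifolds*, J. Differential
  Geom. 44 (1996); arXiv:dg-ga/9505001, Proof of Theorem (p. 1). [Matveyev1996]
* R. Kirby, *Akbulut's corks and h-cobordisms of smooth, simply connected 4-manifolds*, Turkish J.
  Math. 20 (1996); arXiv:math/9712231, §2. [KirbyCorks1996]
-/

noncomputable section

open scoped Manifold ContDiff Topology ContinuousMap
open Set Function Metric Topology
open Literature.AlgebraicTopology.SingularHomology
open Literature.AlgebraicTopology.FundamentalGroup

namespace Literature.Topology.FourManifolds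

/-! ### §1 The relational gluing form -/

section PiOne

variable {EX HX : Type*} [NormedAddCommGroup EX] [NormedSpace ℝ EX] [TopologicalSpace HX]
  {IX : ModelWithCorners ℝ EX HX} {X : Type} [TopologicalSpace X] [ChartedSpace HX X] [T2Space X]
  {ι : Type} [Finite ι] {k l : ℕ} {ν : FramedSphereFamily IX X ι k (l + 1)}
  {P : Type} [TopologicalSpace P] [T2Space P]
  {jA : ↥(ν.coresᶜ) → P} {jB : ↥(ballTimesSphere ι k l) → P}
  (hA : IsOpenEmbedding jA) (hB : IsOpenEmbedding jB) (hcov : range jA ∪ range jB = univ)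
  (hrel : ∀ a b, jA a = jB b ↔ sphereFamilySurgeryRel ν a b)

namespace FramedSphereFamily

include hA hB hcov hrel in
/-- **If a family surgery of index `k + 1 ≥ 3` with cospheres `Sˡ`, `l ≥ 1`, produces a simply
connected space `P`, then the sphere complement `X ∖ ⋃ Sᵢ` was simply connected** (Kosinski
1993, X.2, proof of (2.2), read backwards: `P ∖ ⋃ S'ᵢ = jA(X ∖ ⋃ Sᵢ)` for the cocores
`S'ᵢ ≅ Sˡ`, which have product neighbourhoods `Sˡ × ℝᵏ⁺¹` with simply connected punctured fibre,
so removing them from the simply connected `P` leaves a simply connected space).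
[cite: Kosinski1993, Ch. X §2, Thm. 2.2 (proof)] [cite: MilnorHCobordism1965, §3 p. 21] -/
theorem simplyConnectedSpace_compl_of_surgery_family [SimplyConnectedSpace P]
    (hk : 2 ≤ k) (hl : 1 ≤ l) : SimplyConnectedSpace ↥(ν.coresᶜ) := by
  haveI := Fintype.ofFinite ι
  obtain ⟨ψ, hψ, hdisj, hψ0⟩ := exists_coTubes (ι := ι) (k := k) (l := l) hB
  haveI := pathConnectedSpace_sphere (n := l) (by omega)
  haveI := simplyConnectedSpace_compl_zero (l := k) hk
  -- removing the cocores from `P` keeps it simply connected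
  have hP' : SimplyConnectedSpace
      ↥(⋃ i, ψ i '' (univ ×ˢ ({0} : Set (EuclideanSpace ℝ (Fin (k + 1))))))ᶜ :=
    (simplyConnectedSpace_compl_iUnion_core_iff (W := P)
      (Z := (Metric.sphere (0 : EuclideanSpace ℝ (Fin (l + 1))) 1))
      (E := EuclideanSpace ℝ (Fin (k + 1))) ψ hψ hdisj).2 inferInstance
  -- and that complement is `jA(X ∖ cores) ≅ X ∖ cores`
  rw [compl_iUnion_coCore_eq_range hcov hrel hψ0] at hP'
  exact (hA.isEmbedding.toHomeomorph (X := ↥(ν.coresᶜ))).toHomotopyEquiv.simplyConnectedSpace_iff.2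
    hP'

include hA hB hcov hrel in
/-- **`π₁` through a family surgery of index `k + 1 ≥ 3` with cospheres `Sˡ`, `l ≥ 1`: the
surgered space is simply connected iff the sphere complement `X ∖ ⋃ Sᵢ` is** (the two halves:
`simplyConnectedSpace_of_surgery_family_of_compl` of the companion file and
`simplyConnectedSpace_compl_of_surgery_family`).
[cite: Kosinski1993, Ch. X §2, Thm. 2.2 (proof)] [cite: MilnorHCobordism1965, §3 p. 21] -/
theorem simplyConnectedSpace_iff_compl_of_surgery_family (hk : 2 ≤ k) (hl : 1 ≤ l) :
    SimplyConnectedSpace P ↔ SimplyConnectedSpace ↥(ν.coresᶜ) :=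
  ⟨fun _ => simplyConnectedSpace_compl_of_surgery_family hA hB hcov hrel hk hl,
    fun _ => simplyConnectedSpace_of_surgery_family_of_compl hA hB hcov hrel hk hl⟩

end FramedSphereFamily

end PiOne

/-! ### §2 The surgered manifold `χ(X, φ₁, …, φᵣ)` of the tree -/

section Surgered

variable {n k l : ℕ} {X : Type} [TopologicalSpace X] [ChartedSpace (EuclideanHalfSpace (n + 1)) X]
  [T2Space X] [IsManifold (𝓡∂ (n + 1)) ∞ X] {ι : Type} [Finite ι] [Nonempty ι]

namespace FramedSphereFamily

/-- **If the surgered manifold `χ(X, ν)` of a finite framed family of index `k + 1 ≥ 3` with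
cospheres `Sˡ`, `l ≥ 1`, is simply connected, then so is `X ∖ ⋃ Sᵢ`.**
[cite: Kosinski1993, Ch. X §2, Thm. 2.2 (proof)] [cite: MilnorHCobordism1965, Def. 3.11, §3 p. 21] -/
theorem simplyConnectedSpace_compl_of_surgered_family
    (ν : FramedSphereFamily (𝓡∂ (n + 1)) X ι k (l + 1)) (hkl : k + l = n)
    [SimplyConnectedSpace (ν.Surgered hkl)] (hk : 2 ≤ k) (hl : 1 ≤ l) :
    SimplyConnectedSpace ↥(ν.coresᶜ) := by
  obtain ⟨hA, hB, hcov, hrel⟩ := ν.surgered_gluing_family hkl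
  exact simplyConnectedSpace_compl_of_surgery_family hA hB hcov hrel hk hl

/-- **`π₁` through the surgered manifold of the tree**: for a finite framed family of index
`k + 1 ≥ 3` with cospheres `Sˡ`, `l ≥ 1`, `χ(X, ν)` is simply connected iff `X ∖ ⋃ Sᵢ` is.
[cite: Kosinski1993, Ch. X §2, Thm. 2.2 (proof)] [cite: MilnorHCobordism1965, Def. 3.11, §3 p. 21] -/
theorem simplyConnectedSpace_surgered_iff_compl
    (ν : FramedSphereFamily (𝓡∂ (n + 1)) X ι k (l + 1)) (hkl : k + l = n) (hk : 2 ≤ k)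
    (hl : 1 ≤ l) : SimplyConnectedSpace (ν.Surgered hkl) ↔ SimplyConnectedSpace ↥(ν.coresᶜ) := by
  obtain ⟨hA, hB, hcov, hrel⟩ := ν.surgered_gluing_family hkl
  exact simplyConnectedSpace_iff_compl_of_surgery_family hA hB hcov hrel hk hl

end FramedSphereFamily

end Surgered

/-! ### §3 The relational predicate `ν.IsSurgery IP P` -/

section IsSurgery

variable {EX HX : Type*} [NormedAddCommGroup EX] [NormedSpace ℝ EX] [TopologicalSpace HX]
  {IX : ModelWithCorners ℝ EX HX} {X : Type} [TopologicalSpace X] [ChartedSpace HX X] [T2Space X]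
  {ι : Type} [Finite ι] {k l : ℕ} {ν : FramedSphereFamily IX X ι k (l + 1)}
  {EP HP : Type*} [NormedAddCommGroup EP] [NormedSpace ℝ EP] [TopologicalSpace HP]
  {IP : ModelWithCorners ℝ EP HP} {P : Type} [TopologicalSpace P] [ChartedSpace HP P] [T2Space P]

namespace FramedSphereFamily

omit [T2Space P] in
/-- The piece embeddings of a surgery `ν.IsSurgery IP P` are open embeddings covering `P` along
Milnor's identification (the topological content of the predicate).
[cite: MilnorHCobordism1965, Def. 3.11 (PDF p. 17), §3 (PDF p. 21)] -/
theorem IsSurgery.exists_isOpenEmbedding (h : ν.IsSurgery IP P) :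
    ∃ (jA : ↥(ν.coresᶜ) → P) (jB : ↥(ballTimesSphere ι k l) → P),
      IsOpenEmbedding jA ∧ IsOpenEmbedding jB ∧ range jA ∪ range jB = univ ∧
        ∀ a b, jA a = jB b ↔ sphereFamilySurgeryRel ν a b := by
  obtain ⟨jA, jB, hjA, hAo, hjB, hBo, hU, hR⟩ := h
  exact ⟨jA, jB, ⟨hjA.isEmbedding, hAo⟩, ⟨hjB.isEmbedding, hBo⟩, hU, hR⟩

/-- **If `P` is obtained from `X` by surgery along a finite disjoint framed family of `k`-spheres
with cospheres `Sˡ` (`k ≥ 2`, `l ≥ 1`) and `P` is simply connected, then `X ∖ ⋃ Sᵢ` is simply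
connected.** [cite: Kosinski1993, Ch. X §2, Thm. 2.2 (proof)] [cite: MilnorHCobordism1965, Def. 3.11, §3 p. 21] -/
theorem IsSurgery.simplyConnectedSpace_compl (h : ν.IsSurgery IP P) [SimplyConnectedSpace P]
    (hk : 2 ≤ k) (hl : 1 ≤ l) : SimplyConnectedSpace ↥(ν.coresᶜ) := by
  obtain ⟨jA, jB, hA, hB, hcov, hrel⟩ := h.exists_isOpenEmbedding
  exact simplyConnectedSpace_compl_of_surgery_family hA hB hcov hrel hk hl

/-- **If `P` is obtained from `X` by surgery along a finite disjoint framed family of `k`-spheres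
with cospheres `Sˡ` (`k ≥ 2`, `l ≥ 1`) and `X ∖ ⋃ Sᵢ` is simply connected, then `P` is simply
connected** (the companion file's theorem in the `IsSurgery` vocabulary).
[cite: Kosinski1993, Ch. X §2, Thm. 2.2 (proof)] [cite: MilnorHCobordism1965, Def. 3.11, §3 p. 21] -/
theorem IsSurgery.simplyConnectedSpace_of_compl (h : ν.IsSurgery IP P)
    [SimplyConnectedSpace ↥(ν.coresᶜ)] (hk : 2 ≤ k) (hl : 1 ≤ l) : SimplyConnectedSpace P := by
  obtain ⟨jA, jB, hA, hB, hcov, hrel⟩ := h.exists_isOpenEmbedding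
  exact simplyConnectedSpace_of_surgery_family_of_compl hA hB hcov hrel hk hl

/-- **`π₁` through a surgery of index `k + 1 ≥ 3` with cospheres `Sˡ`, `l ≥ 1`**: the result is
simply connected iff the sphere complement is.
[cite: Kosinski1993, Ch. X §2, Thm. 2.2 (proof)] [cite: MilnorHCobordism1965, Def. 3.11, §3 p. 21] -/
theorem IsSurgery.simplyConnectedSpace_iff_compl (h : ν.IsSurgery IP P) (hk : 2 ≤ k)
    (hl : 1 ≤ l) : SimplyConnectedSpace P ↔ SimplyConnectedSpace ↥(ν.coresᶜ) := by
  obtain ⟨jA, jB, hA, hB, hcov, hrel⟩ := h.exists_isOpenEmbedding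
  exact simplyConnectedSpace_iff_compl_of_surgery_family hA hB hcov hrel hk hl

end FramedSphereFamily

end IsSurgery

/-! ### §4 Two-spheres in a four-manifold -/

section FourDim

variable {N : Type} [TopologicalSpace N] [ChartedSpace (EuclideanSpace ℝ (Fin 4)) N] [T2Space N]
  {ι : Type} [Finite ι]
  {X₁ : Type} [TopologicalSpace X₁] [ChartedSpace (EuclideanSpace ℝ (Fin 4)) X₁] [T2Space X₁]

namespace FramedSphereFamily

/-- **Surgery on 2-spheres in a 4-manifold: the sphere complement is simply connected when the
result is** (Matveyev 1996, Proof of Theorem, p. 1: *"surgery along `{Pᵢ}` gives `M₁`; along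
`{Sᵢ}` gives `M₂` … `N ∖ S_*`, as well as … `N ∖ P_*` … are simply-connected manifolds"*; Kirby
1996, §2).  For a finite disjoint framed family `ν` of 2-spheres `Pⱼ` with 2-dimensional normal
fibre in a smooth 4-manifold `N` and a simply connected `X₁` obtained from `N` by surgery along
`ν` (each `Pⱼ × OD²` replaced by `OD³ × S¹`), the complement `N ∖ ⋃ Pⱼ` is simply connected: it
is `X₁` with the cocore circles, of codimension `3`, removed.  This is the setting of
`Literature.Topology.FourManifolds.Matveyev1996_partOne_and_fact_of_dualSpheres`
(`P.IsSurgery (𝓡 4) X₁`, `S.IsSurgery (𝓡 4) X₂` with `X₁`, `X₂` simply connected).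
[cite: Matveyev1996, Proof of Theorem (arXiv p. 1)] [cite: Kosinski1993, Ch. X §2, Thm. 2.2 (proof)] -/
theorem IsSurgery.simplyConnectedSpace_compl_two_two (ν : FramedSphereFamily (𝓡 4) N ι 2 2)
    (h : ν.IsSurgery (𝓡 4) X₁) [SimplyConnectedSpace X₁] : SimplyConnectedSpace ↥(ν.coresᶜ) :=
  h.simplyConnectedSpace_compl le_rfl le_rfl

/-- **Surgery on 2-spheres in a 4-manifold, `π₁` both ways**: for `X₁` obtained from `N` by
surgery along a finite disjoint framed family of 2-spheres, `X₁` is simply connected iff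
`N ∖ ⋃ Pⱼ` is. [cite: Matveyev1996, Proof of Theorem (arXiv pp. 1–2)] [cite: Kosinski1993, Ch. X §2, Thm. 2.2 (proof)] -/
theorem IsSurgery.simplyConnectedSpace_iff_compl_two_two (ν : FramedSphereFamily (𝓡 4) N ι 2 2)
    (h : ν.IsSurgery (𝓡 4) X₁) : SimplyConnectedSpace X₁ ↔ SimplyConnectedSpace ↥(ν.coresᶜ) :=
  h.simplyConnectedSpace_iff_compl le_rfl le_rfl

end FramedSphereFamily

end FourDim

end Literature.Topology.FourManifolds

end
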